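import Literature.Geometry.Lorentzian.KerrBoyerLindquistExtrinsicForm
import Literature.Geometry.Lorentzian.KerrBoyerLindquistDecay
import Literature.Geometry.Lorentzian.DecaySymbolsBilinear
import Literature.Geometry.Lorentzian.DecaySymbolsSqrtElliptic
import HarnessLib

/-!
# The Boyer–Lindquist slice of Kerr in quasi-isotropic coordinates: decay of the second
# fundamental form

The closed form `k = α⁻¹ (k₁ (dR ⊗ ϖ + ϖ ⊗ dR) + k₂ (dμ ⊗ ϖ + ϖ ⊗ dμ))` (`Kerr.BL.kRepCLM`) of the
second fundamental form of the Boyer–Lindquist slice of Kerr in quasi-isotropic Cartesian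
coordinates is a bilinear-form-valued smooth symbol of order `−3`:

  `k = O₂(ρ⁻³)` (`isBigOSmooth_kRepCLM`),

in particular `k = o₁(ρ⁻²)`, the extrinsic half of Dafermos–Rodnianski admissibility. Bookkeeping
in the symbol calculus `IsBigOSmooth`: `dR = O₂(1)`, `ϖ = O₂(ρ⁻¹)`, `dμ = O₂(ρ⁻¹)` (linear symbols
and `ρ⁻¹`), `Δ(R) = q² ≥ ρ²/4`, `Σ ≥ ρ²/4`, `A ≥ R²Σ ≥ ρ⁴/16` far out, so `1/(AΣ) = O₂(ρ⁻⁶)`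
(inverse of an elliptic symbol) and `k₁ = O₂(ρ⁻²)`, `k₂ = O₂(ρ⁻³)`; the inverse lapse
`α⁻¹ = √(A/(ΔΣ))` is the square root of the elliptic order-zero symbol `A/(ΔΣ) ≥ 1`
(`IsBigOSmooth.sqrt_of_elliptic`).

References: Brandt–Seidel, Phys. Rev. D 54 (1996) 1403, §II; M. Dafermos, I. Rodnianski, Clay
lecture notes (2013), App. B.2.3; R. Bartnik, CPAM 39 (1986), Def. 2.1, Prop. 2.2.
-/

noncomputable section

-- instance search through the nested operator types `E3 →L[ℝ] E3 →L[ℝ] ℝ`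
set_option maxSynthPendingDepth 3

open Bundle TopologicalSpace Set Module Filter Asymptotics Bornology
open scoped InnerProductSpace Topology

namespace Literature.Geometry.Lorentzian

namespace Kerr.BL

open Kerr.Ingoing

variable {M a : ℝ}

/-! ### The slice differentials as symbols -/

/-- `q(ρ) = ρ − (M² − a²)/(4ρ) = O₂(ρ)`. [cite: BrandtSeidel1996, §II] -/
theorem isBigOSmooth_qiRoot (M a : ℝ) : IsBigOSmooth 2 1 fun y : E3 ↦ qiRoot M a ‖y‖ := by
  refine (isBigOSmooth_norm.sub (((isBigOSmooth_inv_norm (E := E3)).const_mul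
    ((M ^ 2 - a ^ 2) / 4)).mono (by norm_num))).congr fun y ↦ ?_
  unfold qiRoot
  ring

/-- The covector field `y ↦ ⟨y, ·⟩` is a symbol of order one. [folklore] -/
theorem isBigOSmooth_covec : IsBigOSmooth 2 1 fun y : E3 ↦ E3.covec y :=
  isBigOSmooth_two_clm (innerSL ℝ (E := E3) : E3 →L[ℝ] E3 →L[ℝ] ℝ)

/-- **`dR = O₂(1)`**: `dR_y = (q/ρ)ρ⁻¹ ⟨y, ·⟩`. [cite: BrandtSeidel1996, §II] -/
theorem isBigOSmooth_dRCLM (M a : ℝ) : IsBigOSmooth 2 0 fun y : E3 ↦ dRCLM M a y := by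
  have hs : IsBigOSmooth 2 (-1) fun y : E3 ↦ qiRoot M a ‖y‖ / ‖y‖ * ‖y‖⁻¹ := by
    have h := ((isBigOSmooth_qiRoot M a).mul (isBigOSmooth_inv_norm (E := E3))).mul
      (isBigOSmooth_inv_norm (E := E3))
    rw [show (1 : ℝ) + -1 + -1 = -1 by norm_num] at h
    exact h.congr fun y ↦ by rw [div_eq_mul_inv]
  have h := hs.smul isBigOSmooth_covec
  rw [show (-1 : ℝ) + 1 = 0 by norm_num] at h
  exact h.congr fun y ↦ rfl

/-- **`ϖ = O₂(ρ⁻¹)`**: `ϖ_y = ρ⁻²(y₁dy₂ − y₂dy₁)`. [cite: BrandtSeidel1996, §II] -/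
theorem isBigOSmooth_rotFormCLM : IsBigOSmooth 2 (-1) (rotFormCLM : E3 → E3 →L[ℝ] ℝ) := by
  have hL : IsBigOSmooth 2 1 fun y : E3 ↦
      y 0 • (EuclideanSpace.proj 1 : E3 →L[ℝ] ℝ) - y 1 • (EuclideanSpace.proj 0 : E3 →L[ℝ] ℝ) :=
    ((isBigOSmooth_two_apply (n := 3) 0).smul_const _).sub
      ((isBigOSmooth_two_apply (n := 3) 1).smul_const _)
  have h2 : IsBigOSmooth 2 (-2) fun y : E3 ↦ (‖y‖ ^ 2)⁻¹ := by
    have h := (isBigOSmooth_inv_norm (E := E3)).mul isBigOSmooth_inv_norm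
    rw [show (-1 : ℝ) + -1 = -2 by norm_num] at h
    exact h.congr fun y ↦ by rw [sq, mul_inv]
  have h := h2.smul hL
  rw [show (-2 : ℝ) + 1 = -1 by norm_num] at h
  exact h.congr fun y ↦ rfl

/-- **`dμ = O₂(ρ⁻¹)`**: `dμ_y = ρ⁻¹ dy₃ − (y₃/ρ³)⟨y, ·⟩`. [folklore] -/
theorem isBigOSmooth_dMuCLM : IsBigOSmooth 2 (-1) (dMuCLM : E3 → E3 →L[ℝ] ℝ) := by
  have h1 : IsBigOSmooth 2 (-1) fun y : E3 ↦ ‖y‖⁻¹ • (EuclideanSpace.proj (𝕜 := ℝ) (2 : Fin 3) :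
      E3 →L[ℝ] ℝ) := (isBigOSmooth_inv_norm (E := E3)).smul_const _
  have hc : IsBigOSmooth 2 (-2) fun y : E3 ↦ y 2 / ‖y‖ ^ 3 := by
    have h := (((isBigOSmooth_two_apply (n := 3) 2).mul (isBigOSmooth_inv_norm (E := E3))).mul
      (isBigOSmooth_inv_norm (E := E3))).mul (isBigOSmooth_inv_norm (E := E3))
    rw [show (1 : ℝ) + -1 + -1 + -1 = -2 by norm_num] at h
    refine h.congr fun y ↦ ?_
    rw [div_eq_mul_inv, pow_succ, pow_two, mul_inv, mul_inv]
    ring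
  have h2 := hc.smul isBigOSmooth_covec
  rw [show (-2 : ℝ) + 1 = -1 by norm_num] at h2
  exact (h1.sub h2).congr fun y ↦ rfl

/-! ### Far-field estimates: ellipticity of `Δ`, `Σ`, `A` -/

/-- Far out: `ρ ≥ 1`, `q ≥ ρ/2`, `R ≥ ρ/2`, `Δ(R) ≥ ρ²/4`, `Σ ≥ ρ²/4`. [cite: BrandtSeidel1996, §II] -/
theorem far_estimates (M a : ℝ) : ∀ᶠ y in cobounded E3,
    1 ≤ ‖y‖ ∧ ‖y‖ / 2 ≤ qiRoot M a ‖y‖ ∧ ‖y‖ / 2 ≤ qiRadius M a ‖y‖ ∧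
      1 / 4 * ‖y‖ ^ 2 ≤ Ingoing.delta M a (qiRadius M a ‖y‖) ∧
      1 / 4 * ‖y‖ ^ 2 ≤ qiRadius M a ‖y‖ ^ 2 + a ^ 2 * (y 2 / ‖y‖) ^ 2 := by
  filter_upwards [eventually_cobounded_le_norm (E := E3) (1 + a ^ 2 + M ^ 2 + 2 * |M|),
    blSigma_lower M a] with y hy hSg
  have ha : 0 ≤ a ^ 2 := sq_nonneg a
  have hM2 : 0 ≤ M ^ 2 := sq_nonneg M
  have hMabs : 0 ≤ |M| := abs_nonneg M
  have hMle : -|M| ≤ M := neg_abs_le M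
  have hρ1 : 1 ≤ ‖y‖ := by linarith
  have hρ : 0 < ‖y‖ := by linarith
  have hq : ‖y‖ / 2 ≤ qiRoot M a ‖y‖ := by
    unfold qiRoot
    have h1 : (M ^ 2 - a ^ 2) / (4 * ‖y‖) ≤ M ^ 2 / 4 := by
      rw [div_le_iff₀ (by positivity)]
      nlinarith [mul_nonneg hM2 (by linarith : (0 : ℝ) ≤ ‖y‖ - 1)]
    linarith
  have hR : ‖y‖ / 2 ≤ qiRadius M a ‖y‖ := by
    unfold qiRadius
    have h1 : -a ^ 2 / 4 ≤ (M ^ 2 - a ^ 2) / (4 * ‖y‖) := by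
      rw [le_div_iff₀ (by positivity)]
      nlinarith [mul_nonneg ha (by linarith : (0 : ℝ) ≤ ‖y‖ - 1)]
    linarith
  have hΔ : 1 / 4 * ‖y‖ ^ 2 ≤ Ingoing.delta M a (qiRadius M a ‖y‖) := by
    rw [delta_qiRadius M a hρ.ne']
    have hq0 : 0 ≤ ‖y‖ / 2 := by positivity
    nlinarith [mul_le_mul hq hq hq0 (hq0.trans hq)]
  rw [Real.rpow_two] at hSg
  exact ⟨hρ1, hq, hR, hΔ, hSg⟩

/-- `(y₃/‖y‖)² ≤ 1`. [folklore] -/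
private theorem sq_div_norm_le_one' (y : E3) : (y 2 / ‖y‖) ^ 2 ≤ 1 := sq_div_norm_le_one y

/-- **`Δ(R) = O₂(ρ²)`**. [cite: BrandtSeidel1996, §II] -/
theorem isBigOSmooth_delta_qiRadius (M a : ℝ) :
    IsBigOSmooth 2 2 fun y : E3 ↦ Ingoing.delta M a (qiRadius M a ‖y‖) := by
  have hR := isBigOSmooth_qiRadius M a
  have h2 := hR.mul hR
  rw [show (1 : ℝ) + 1 = 2 by norm_num] at h2
  refine ((h2.sub ((hR.const_mul (2 * M)).mono (by norm_num))).add
    ((isBigOSmooth_const 2 (a ^ 2)).mono (by norm_num))).congr fun y ↦ ?_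
  simp only [Ingoing.delta]
  ring

/-- **`A = O₂(ρ⁴)`**. [cite: BrandtSeidel1996, §II] -/
theorem isBigOSmooth_bigA (M a : ℝ) : IsBigOSmooth 2 4 (bigA M a) := by
  have hR := isBigOSmooth_qiRadius M a
  have h2 := hR.mul hR
  rw [show (1 : ℝ) + 1 = 2 by norm_num] at h2
  have hS := isBigOSmooth_blSigma M a
  have hA1 := (h2.add ((isBigOSmooth_const 2 (a ^ 2)).mono (by norm_num))).mul hS
  rw [show (2 : ℝ) + 2 = 4 by norm_num] at hA1
  have hμ : IsBigOSmooth 2 0 fun y : E3 ↦ 1 - (y 2 / ‖y‖) ^ 2 :=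
    (isBigOSmooth_const 2 (1 : ℝ)).sub isBigOSmooth_latSq
  have hA2 := ((hR.const_mul (2 * M)).const_mul (a ^ 2)).mul hμ
  rw [show (1 : ℝ) + 0 = 1 by norm_num] at hA2
  refine (hA1.add (hA2.mono (by norm_num))).congr fun y ↦ ?_
  unfold bigA sigmaE
  ring

/-- **`1/(AΣ) = O₂(ρ⁻⁶)`** (`A Σ ≥ ρ⁶/64` far out for `0 ≤ M`). [cite: BrandtSeidel1996, §II] -/
theorem isBigOSmooth_inv_bigA_mul_sigma (hM : 0 ≤ M) (a : ℝ) :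
    IsBigOSmooth 2 (-6) fun y : E3 ↦ (bigA M a y * sigmaE M a y)⁻¹ := by
  have h := (isBigOSmooth_bigA M a).mul (isBigOSmooth_blSigma M a)
  rw [show (4 : ℝ) + 2 = 6 by norm_num] at h
  refine h.inv_of_elliptic (c := 1 / 64) (by norm_num) ?_
  filter_upwards [far_estimates M a] with y ⟨hρ1, _, hR, _, hSg⟩
  have hR0 : 0 ≤ ‖y‖ / 2 := by linarith
  have hR2 : 1 / 4 * ‖y‖ ^ 2 ≤ qiRadius M a ‖y‖ ^ 2 := by nlinarith [mul_le_mul hR hR hR0 (hR0.trans hR)]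
  have hRpos : 0 ≤ qiRadius M a ‖y‖ := hR0.trans hR
  have hμ : 0 ≤ 1 - (y 2 / ‖y‖) ^ 2 := sub_nonneg.2 (sq_div_norm_le_one y)
  have hS0 : 0 ≤ qiRadius M a ‖y‖ ^ 2 + a ^ 2 * (y 2 / ‖y‖) ^ 2 := by positivity
  have hA : 1 / 16 * ‖y‖ ^ 4 ≤ bigA M a y := by
    unfold bigA sigmaE
    have h1 : qiRadius M a ‖y‖ ^ 2 * (qiRadius M a ‖y‖ ^ 2 + a ^ 2 * (y 2 / ‖y‖) ^ 2) ≤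
        (qiRadius M a ‖y‖ ^ 2 + a ^ 2) * (qiRadius M a ‖y‖ ^ 2 + a ^ 2 * (y 2 / ‖y‖) ^ 2) :=
      mul_le_mul_of_nonneg_right (by nlinarith) hS0
    have h2 : 0 ≤ 2 * M * qiRadius M a ‖y‖ * a ^ 2 * (1 - (y 2 / ‖y‖) ^ 2) := by positivity
    have h3 : 1 / 16 * ‖y‖ ^ 4 ≤ qiRadius M a ‖y‖ ^ 2 * (qiRadius M a ‖y‖ ^ 2 + a ^ 2 * (y 2 / ‖y‖) ^ 2) := by
      have : 1 / 16 * ‖y‖ ^ 4 = (1 / 4 * ‖y‖ ^ 2) * (1 / 4 * ‖y‖ ^ 2) := by ring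
      rw [this]
      exact mul_le_mul hR2 hSg (by positivity) (by positivity)
    linarith
  rw [show (6 : ℝ) = ((6 : ℕ) : ℝ) by norm_num, Real.rpow_natCast]
  have : 1 / 64 * ‖y‖ ^ 6 = (1 / 16 * ‖y‖ ^ 4) * (1 / 4 * ‖y‖ ^ 2) := by ring
  rw [this]
  exact mul_le_mul hA hSg (by positivity) ((by positivity : (0:ℝ) ≤ 1 / 16 * ‖y‖ ^ 4).trans hA)

/-! ### The coefficient functions and the inverse lapse as symbols -/

/-- **`k₁ = O₂(ρ⁻²)`**. [cite: BrandtSeidel1996, §II] -/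
theorem isBigOSmooth_kOne (hM : 0 ≤ M) (a : ℝ) : IsBigOSmooth 2 (-2) (kOne M a) := by
  have hR := isBigOSmooth_qiRadius M a
  have h2 := hR.mul hR
  rw [show (1 : ℝ) + 1 = 2 by norm_num] at h2
  have hS := isBigOSmooth_blSigma M a
  have hN : IsBigOSmooth 2 4 fun y : E3 ↦ M * a * (sigmaE M a y * (qiRadius M a ‖y‖ ^ 2 - a ^ 2) +
      2 * qiRadius M a ‖y‖ ^ 2 * (qiRadius M a ‖y‖ ^ 2 + a ^ 2)) := by
    have hA := hS.mul (h2.sub ((isBigOSmooth_const 2 (a ^ 2)).mono (by norm_num)))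
    have hB := (h2.const_mul 2).mul (h2.add ((isBigOSmooth_const 2 (a ^ 2)).mono (by norm_num)))
    rw [show (2 : ℝ) + 2 = 4 by norm_num] at hA hB
    refine ((hA.add hB).const_mul (M * a)).congr fun y ↦ ?_
    unfold sigmaE
    ring
  have h := hN.mul (isBigOSmooth_inv_bigA_mul_sigma hM a)
  rw [show (4 : ℝ) + -6 = -2 by norm_num] at h
  refine h.neg.congr fun y ↦ ?_
  unfold kOne
  rw [neg_div, div_eq_mul_inv]

/-- **`k₂ = O₂(ρ⁻²)`** (indeed `O₂(ρ⁻³)`). [cite: BrandtSeidel1996, §II] -/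
theorem isBigOSmooth_kTwo (hM : 0 ≤ M) (a : ℝ) : IsBigOSmooth 2 (-2) (kTwo M a) := by
  have hR := isBigOSmooth_qiRadius M a
  have hμ : IsBigOSmooth 2 0 fun y : E3 ↦ y 2 / ‖y‖ := by
    have h := (isBigOSmooth_two_apply (n := 3) 2).mul (isBigOSmooth_inv_norm (E := E3))
    rw [show (1 : ℝ) + -1 = 0 by norm_num] at h
    exact h.congr fun y ↦ by rw [div_eq_mul_inv]
  have hN : IsBigOSmooth 2 3 fun y : E3 ↦ 2 * M * qiRadius M a ‖y‖ * a ^ 3 * (y 2 / ‖y‖) *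
      Ingoing.delta M a (qiRadius M a ‖y‖) := by
    have h := ((((hR.const_mul (2 * M)).mul ((isBigOSmooth_const 2 (a ^ 3)))).mul hμ).mul
      (isBigOSmooth_delta_qiRadius M a))
    rw [show (1 : ℝ) + 0 + 0 + 2 = 3 by norm_num] at h
    exact h
  have h := hN.mul (isBigOSmooth_inv_bigA_mul_sigma hM a)
  rw [show (3 : ℝ) + -6 = -3 by norm_num] at h
  refine (h.neg.mono (by norm_num)).congr fun y ↦ ?_
  unfold kTwo
  rw [neg_div, div_eq_mul_inv, div_eq_mul_inv]

/-- **The inverse lapse is an order-zero symbol**: `α⁻¹ = √(A/(ΔΣ))` with `A/(ΔΣ) = O₂(1)` elliptic,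
`A/(ΔΣ) ≥ 1` far out (`A − ΔΣ = 2MR(Σ + a² sin²θ) ≥ 0` for `0 ≤ M`). [cite: BrandtSeidel1996, §II] -/
theorem isBigOSmooth_lapseE_inv (hM : 0 ≤ M) (a : ℝ) :
    IsBigOSmooth 2 0 fun y : E3 ↦ (lapseE M a y)⁻¹ := by
  -- `1/(ΔΣ) = O₂(ρ⁻⁴)`
  have hDS : IsBigOSmooth 2 (-4) fun y : E3 ↦
      (Ingoing.delta M a (qiRadius M a ‖y‖) * sigmaE M a y)⁻¹ := by
    have h := (isBigOSmooth_delta_qiRadius M a).mul (isBigOSmooth_blSigma M a)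
    rw [show (2 : ℝ) + 2 = 4 by norm_num] at h
    refine h.inv_of_elliptic (c := 1 / 16) (by norm_num) ?_
    filter_upwards [far_estimates M a] with y ⟨hρ1, _, _, hΔ, hSg⟩
    rw [show (4 : ℝ) = ((4 : ℕ) : ℝ) by norm_num, Real.rpow_natCast]
    have : 1 / 16 * ‖y‖ ^ 4 = (1 / 4 * ‖y‖ ^ 2) * (1 / 4 * ‖y‖ ^ 2) := by ring
    rw [this]
    exact mul_le_mul hΔ hSg (by positivity) ((by positivity : (0:ℝ) ≤ 1 / 4 * ‖y‖ ^ 2).trans hΔ)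
  -- `q = A/(ΔΣ) = O₂(1)`, `q ≥ 1`
  have hq := (isBigOSmooth_bigA M a).mul hDS
  rw [show (4 : ℝ) + -4 = 0 by norm_num] at hq
  have hlow : ∀ᶠ y in cobounded E3, 1 * ‖y‖ ^ (0 : ℝ) ≤
      bigA M a y * (Ingoing.delta M a (qiRadius M a ‖y‖) * sigmaE M a y)⁻¹ := by
    filter_upwards [far_estimates M a] with y ⟨hρ1, _, hR, hΔ, hSg⟩
    have hρ : 0 < ‖y‖ := by linarith
    have hRpos : 0 ≤ qiRadius M a ‖y‖ := (by positivity : (0:ℝ) ≤ ‖y‖ / 2).trans hR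
    have hμ : 0 ≤ 1 - (y 2 / ‖y‖) ^ 2 := sub_nonneg.2 (sq_div_norm_le_one y)
    have hΔ0 : 0 < Ingoing.delta M a (qiRadius M a ‖y‖) := lt_of_lt_of_le (by positivity) hΔ
    have hSg0 : 0 < sigmaE M a y := by unfold sigmaE; exact lt_of_lt_of_le (by positivity) hSg
    rw [Real.rpow_zero, mul_one, ← div_eq_mul_inv, le_div_iff₀ (mul_pos hΔ0 hSg0), one_mul]
    have hdiff : 0 ≤ bigA M a y - Ingoing.delta M a (qiRadius M a ‖y‖) * sigmaE M a y := by
      have : bigA M a y - Ingoing.delta M a (qiRadius M a ‖y‖) * sigmaE M a y =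
          2 * M * qiRadius M a ‖y‖ * (sigmaE M a y + a ^ 2 * (1 - (y 2 / ‖y‖) ^ 2)) := by
        unfold bigA Ingoing.delta
        ring
      rw [this]
      have : 0 ≤ sigmaE M a y + a ^ 2 * (1 - (y 2 / ‖y‖) ^ 2) := by positivity
      positivity
    linarith
  have hs := hq.sqrt_of_elliptic (c := 1) one_pos hlow
  rw [zero_div] at hs
  refine hs.congr fun y ↦ ?_
  unfold lapseE
  rw [← Real.sqrt_inv, inv_div, div_eq_mul_inv]

/-! ### The decay of `k` -/

/-- **`k = O₂(ρ⁻³)`**: the second fundamental form of the Boyer–Lindquist slice of Kerr in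
quasi-isotropic Cartesian coordinates is a smooth symbol of order `−3` (`0 ≤ M`), hence
`k = o₁(ρ⁻²)` as required by Dafermos–Rodnianski admissibility. Brandt–Seidel 1996, §II;
Dafermos–Rodnianski 2013, App. B.2.3. [cite: BrandtSeidel1996, §II] -/
theorem isBigOSmooth_kRepCLM (hM : 0 ≤ M) (a : ℝ) : IsBigOSmooth 2 (-3) (kRepCLM M a) := by
  have hdR := isBigOSmooth_dRCLM M a
  have hrot := isBigOSmooth_rotFormCLM
  have hdM := isBigOSmooth_dMuCLM
  have hT1 : IsBigOSmooth 2 (-1) fun y : E3 ↦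
      (dRCLM M a y).smulRight (rotFormCLM y) + (rotFormCLM y).smulRight (dRCLM M a y) := by
    have hA := hdR.smulRight hrot
    have hB := hrot.smulRight hdR
    rw [show (0 : ℝ) + -1 = -1 by norm_num] at hA
    rw [show (-1 : ℝ) + 0 = -1 by norm_num] at hB
    exact hA.add hB
  have hT2 : IsBigOSmooth 2 (-1) fun y : E3 ↦
      (dMuCLM y).smulRight (rotFormCLM y) + (rotFormCLM y).smulRight (dMuCLM y) := by
    have hA := hdM.smulRight hrot
    have hB := hrot.smulRight hdM
    rw [show (-1 : ℝ) + -1 = -2 by norm_num] at hA hB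
    exact (hA.add hB).mono (by norm_num)
  have h1 := (isBigOSmooth_kOne hM a).smul hT1
  have h2 := (isBigOSmooth_kTwo hM a).smul hT2
  rw [show (-2 : ℝ) + -1 = -3 by norm_num] at h1 h2
  have h := (isBigOSmooth_lapseE_inv hM a).smul (h1.add h2)
  rw [show (0 : ℝ) + -3 = -3 by norm_num] at h
  exact h.congr fun y ↦ rfl

end Kerr.BL

end Literature.Geometry.Lorentzian

end
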